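import Summits.Ventures.PercRepro.Night2FatXDistTwo

/-!
# night-2: a lossy big pair without good points — the off-point inside it is a coloop with the fat face

In the fat case `G ∖ clF B₀ = {w₀, x}` a lossy big pair `(B, z)` without good points has exactly one off-point
`u` outside `Q = B ∪ {z}`; the other, `v`, is a coloop of `Q' = Q ∖ K` and the face `Q ∖ v` has the fat closure
`clF B₀` (`exists_off_coloop_of_no_gtPts`).  Every point `e` of `V = G ∖ K` other than `w₀, x` lies in `clF B₀`,
and — without good points — on a second face hyperplane `cl (Q ∖ c₂)` or `cl (Q ∖ c₃)` (`c₂, c₃` the two other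
coloops of `Q'`); two of the three face hyperplanes meet in the rank-`4` flat spanned by the line `R = Q' ∖ coloops Q'`,
the third coloop and `K` (modularity), so `two_planes_of_no_gtPts` (Night2FatXTwoPlanes):
`V ∖ {w₀, x} ⊆ cl (R ∪ {c₂}) ∪ cl (R ∪ {c₃})`.  This module has the first step and the rank of a coloop face
(`rkN_erase_coloop_face_eq_five`).  Paper `proofs/NIGHT-2-g33.md` §4.
-/

namespace PercRepro.Shadow

open PercRepro.ThmH PercRepro.PerFlat

variable {α : Type*} [DecidableEq α] {M : Matroid α} [M.Finite] {G : Finset α}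

/-- **The off-point inside a lossy big pair without good points is a coloop whose face has the fat closure**:
`{w₀, x} = {u, v}` with `u ∉ Q`, `v` a coloop of `Q' = Q ∖ K`, and `clF (Q ∖ v) = clF B₀`. -/
theorem exists_off_coloop_of_no_gtPts (hG : G ∈ flatsQ M (5 + 1)) (hd : (gr M \ G).card = 2)
    (hk : kColoops M G = 1) (hs : ∀ e ∈ gr M, ∀ f ∈ gr M, e ≠ f → rkN M {e, f} = 2)
    (hl : ∀ e ∈ gr M, M.Indep {e}) {B₀ : Finset α} (hB₀ : B₀ ∈ thinMembers M 5 G) {w₀ x : α}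
    (hD : G \ clF M B₀ = {w₀, x}) {B : Finset α} (hB : B ∈ thinMembers M 5 G)
    (hbig : 5 ≤ (B \ coloops M G).card) {z : α} (hz : z ∈ G \ clF M B) (h : loss M 5 G B z ≠ 0)
    (hno : ¬ (gtPts M 5 G (insert z B)).Nonempty) :
    ∃ u v : α, ({w₀, x} : Finset α) = {u, v} ∧ u ∉ insert z B ∧
      v ∈ coloops M (insert z B \ coloops M G) ∧ clF M ((insert z B).erase v) = clF M B₀ := by
  have hGg : G ⊆ gr M := (mem_flatsQ.1 hG).1
  have hd' : (gr M \ G).card ≤ 5 := by omega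
  have hQG : insert z B ⊆ G :=
    Finset.insert_subset (Finset.mem_sdiff.1 hz).1 (subset_G_of_mem_thinMembers hB)
  have hKB : coloops M G ⊆ B := coloops_subset_of_mem_thinMembers hG hd' hB
  have hKQ : coloops M G ⊆ insert z B := hKB.trans (Finset.subset_insert _ _)
  have hfaces := thinFacesOf_eq_image_erase hG hd hk hs hl hB hbig hz h
  have hoff := notMem_or_notMem_insert_of_loss_ne_zero hG hd hk hs hl hB₀ hD hB hbig hz h
  obtain ⟨hR2, hRcard⟩ := rkN_sdiff_coloops_eq_two_of_loss_ne_zero hG hd hk hs hl hB hbig hz h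
  have hQ'5 : rkN M (insert z B \ coloops M G) = 5 := rkN_insert_sdiff_coloops_eq_five_of_thin hG hd hk hB hz
  have hQ'G : insert z B \ coloops M G ⊆ G := Finset.sdiff_subset.trans hQG
  have hzB : z ∉ B := fun h' => (Finset.mem_sdiff.1 hz).2 (subset_clF_of_subset_gr
    ((subset_G_of_mem_thinMembers hB).trans hGg) h')
  have hzK : z ∉ coloops M G := fun h' => hzB (hKB h')
  have hR3 : 3 ≤ ((insert z B \ coloops M G) \ coloops M (insert z B \ coloops M G)).card := by
    have heq : insert z B \ coloops M G = insert z (B \ coloops M G) := by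
      ext e
      simp only [Finset.mem_sdiff, Finset.mem_insert]
      constructor
      · rintro ⟨h' | h', h2⟩
        · exact Or.inl h'
        · exact Or.inr ⟨h', h2⟩
      · rintro (rfl | ⟨h', h2⟩)
        · exact ⟨Or.inl rfl, hzK⟩
        · exact ⟨Or.inr h', h2⟩
    have : 6 ≤ (insert z B \ coloops M G).card := by
      rw [heq, Finset.card_insert_of_notMem (fun h' => hzB (Finset.mem_sdiff.1 h').1)]
      omega
    omega
  -- the fat closure has rank `5` and contains `G ∖ {w₀, x}`
  have hB₀G : B₀ ⊆ G := subset_G_of_mem_thinMembers hB₀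
  have hclB₀G : clF M B₀ ⊆ G := (mem_membersIn.1 (mem_thinMembers.1 hB₀).1).2
  have hKB₀ : coloops M G ⊆ B₀ := coloops_subset_of_mem_thinMembers hG hd' hB₀
  have hKcl : coloops M G ⊆ clF M B₀ := hKB₀.trans (subset_clF_of_subset_gr (hB₀G.trans hGg))
  have hrkB₀ : rkN M B₀ = 5 := by
    have h1 := rkN_eq_rkN_sdiff_add_one hG hk hclB₀G (Finset.Subset.refl _) hKcl
    rw [rkN_clF_sdiff_coloops_eq_four_two hG hd hk hB₀, rkN_clF] at h1
    exact h1
  have core : ∀ u v : α, ({w₀, x} : Finset α) = {u, v} → u ∉ insert z B →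
      v ∈ coloops M (insert z B \ coloops M G) ∧ clF M ((insert z B).erase v) = clF M B₀ := by
    intro u v huv huQ
    have huD : u ∈ G \ clF M B₀ := by
      rw [hD, huv]
      exact Finset.mem_insert_self _ _
    have hvD : v ∈ G \ clF M B₀ := by
      rw [hD, huv]
      exact Finset.mem_insert_of_mem (Finset.mem_singleton_self _)
    have huG : u ∈ G := (Finset.mem_sdiff.1 huD).1
    have hucl : u ∉ clF M B₀ := (Finset.mem_sdiff.1 huD).2
    have hin : ∀ e ∈ G, e ≠ u → e ≠ v → e ∈ clF M B₀ := by
      intro e heG heu hev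
      by_contra hc
      have hmem : e ∈ G \ clF M B₀ := Finset.mem_sdiff.2 ⟨heG, hc⟩
      rw [hD, huv, Finset.mem_insert, Finset.mem_singleton] at hmem
      rcases hmem with h' | h'
      · exact heu h'
      · exact hev h'
    have hvQ : v ∈ insert z B := by
      by_contra hvQ
      apply hno
      refine ⟨u, mem_goodPts.2 ⟨Finset.mem_sdiff.2 ⟨huG, huQ⟩, ?_⟩⟩
      have hempty : (thinFacesOf M 5 G (insert z B)).filter (fun F => u ∈ clF M F) = ∅ := by
        rw [Finset.filter_eq_empty_iff]
        intro F hF huF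
        rw [hfaces, Finset.mem_image] at hF
        obtain ⟨c, -, rfl⟩ := hF
        have hsub : (insert z B).erase c ⊆ clF M B₀ := by
          intro e he
          have heQ : e ∈ insert z B := Finset.mem_of_mem_erase he
          exact hin e (hQG heQ) (fun h' => huQ (h' ▸ heQ)) (fun h' => hvQ (h' ▸ heQ))
        exact hucl (clF_subset_clF_of_subset_clF hsub huF)
      rw [hempty, Finset.card_empty]
      omega
    have hRG : (insert z B \ coloops M G) \ coloops M (insert z B \ coloops M G) ⊆ G :=
      Finset.sdiff_subset.trans hQ'G
    have huR : u ∉ (insert z B \ coloops M G) \ coloops M (insert z B \ coloops M G) :=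
      fun h' => huQ (Finset.mem_sdiff.1 (Finset.sdiff_subset h')).1
    have hvR := notMem_of_rkN_le_two_of_notMem hs hG hD hRG (by omega) hR3
      (by rw [huv]; exact Finset.pair_comm _ _) huR
    have hvK : v ∉ coloops M G := fun hvK => (Finset.mem_sdiff.1 hvD).2 (hKcl hvK)
    have hvC : v ∈ coloops M (insert z B \ coloops M G) := by
      by_contra hc
      exact hvR (Finset.mem_sdiff.2 ⟨Finset.mem_sdiff.2 ⟨hvQ, hvK⟩, hc⟩)
    refine ⟨hvC, ?_⟩
    -- the face at `v` lies in `clF B₀` and has rank `5`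
    have hsub : (insert z B).erase v ⊆ clF M B₀ := by
      intro e he
      have heQ : e ∈ insert z B := Finset.mem_of_mem_erase he
      exact hin e (hQG heQ) (fun h'' => huQ (h'' ▸ heQ)) (fun h'' => (Finset.mem_erase.1 he).1 h'')
    have hrk5 : rkN M ((insert z B).erase v) = 5 := by
      have hKc : coloops M G ⊆ (insert z B).erase v := by
        intro e he
        exact Finset.mem_erase.2 ⟨fun h' => hvK (h' ▸ he), hKQ he⟩
      have heq : (insert z B).erase v \ coloops M G = (insert z B \ coloops M G).erase v := by
        ext e
        simp only [Finset.mem_sdiff, Finset.mem_erase]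
        constructor
        · rintro ⟨⟨h1, h2⟩, h3⟩
          exact ⟨h1, h2, h3⟩
        · rintro ⟨h1, h2, h3⟩
          exact ⟨⟨h1, h2⟩, h3⟩
      rw [rkN_eq_rkN_sdiff_add_one hG hk ((Finset.erase_subset _ _).trans hQG) (Finset.Subset.refl _) hKc, heq]
      have hnot : v ∉ clF M ((insert z B \ coloops M G).erase v) := (mem_coloops.1 hvC).2
      have := rkN_insert_of_notMem_clF (M := M) (hGg (hQ'G (mem_coloops.1 hvC).1)) hnot
      rw [Finset.insert_erase (mem_coloops.1 hvC).1, hQ'5] at this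
      omega
    exact clF_eq_clF_of_subset_clF_of_rkN_le (hB₀G.trans hGg) hsub (by rw [hrkB₀, hrk5])
  rcases hoff with hw₀Q | hxQ
  · exact ⟨w₀, x, rfl, hw₀Q, core w₀ x rfl hw₀Q⟩
  · exact ⟨x, w₀, Finset.pair_comm _ _, hxQ, core x w₀ (Finset.pair_comm _ _) hxQ⟩


/-- The face of a lossy big set at a coloop `c` of `Q' = Q ∖ K` has rank `5`. -/
theorem rkN_erase_coloop_face_eq_five (hG : G ∈ flatsQ M (5 + 1)) (hd : (gr M \ G).card = 2)
    (hk : kColoops M G = 1) {B : Finset α} (hB : B ∈ thinMembers M 5 G) {z : α} (hz : z ∈ G \ clF M B)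
    {c : α} (hcC : c ∈ coloops M (insert z B \ coloops M G)) : rkN M ((insert z B).erase c) = 5 := by
  have hGg : G ⊆ gr M := (mem_flatsQ.1 hG).1
  have hd' : (gr M \ G).card ≤ 5 := by omega
  have hQG : insert z B ⊆ G :=
    Finset.insert_subset (Finset.mem_sdiff.1 hz).1 (subset_G_of_mem_thinMembers hB)
  have hKQ : coloops M G ⊆ insert z B :=
    (coloops_subset_of_mem_thinMembers hG hd' hB).trans (Finset.subset_insert _ _)
  have hQ'5 : rkN M (insert z B \ coloops M G) = 5 := rkN_insert_sdiff_coloops_eq_five_of_thin hG hd hk hB hz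
  have hcQ' : c ∈ insert z B \ coloops M G := (mem_coloops.1 hcC).1
  have hcK : c ∉ coloops M G := (Finset.mem_sdiff.1 hcQ').2
  have hKc : coloops M G ⊆ (insert z B).erase c := by
    intro e he
    exact Finset.mem_erase.2 ⟨fun h' => hcK (h' ▸ he), hKQ he⟩
  have heq : (insert z B).erase c \ coloops M G = (insert z B \ coloops M G).erase c := by
    ext e
    simp only [Finset.mem_sdiff, Finset.mem_erase]
    constructor
    · rintro ⟨⟨h1, h2⟩, h3⟩
      exact ⟨h1, h2, h3⟩
    · rintro ⟨h1, h2, h3⟩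
      exact ⟨⟨h1, h2⟩, h3⟩
  rw [rkN_eq_rkN_sdiff_add_one hG hk ((Finset.erase_subset _ _).trans hQG) (Finset.Subset.refl _) hKc, heq]
  have hnot : c ∉ clF M ((insert z B \ coloops M G).erase c) := (mem_coloops.1 hcC).2
  have := rkN_insert_of_notMem_clF (M := M) (hGg (Finset.sdiff_subset.trans hQG hcQ')) hnot
  rw [Finset.insert_erase hcQ', hQ'5] at this
  omega

end PercRepro.Shadow
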